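import Mathlib.Algebra.BigOperators.Ring.Finset
import Mathlib.Algebra.Order.BigOperators.Group.Finset
import Mathlib.Data.Fintype.BigOperators
import Mathlib.Data.Fintype.Pi
import Mathlib.Data.Real.Basic
import Mathlib.Logic.Equiv.Prod
import Mathlib.Tactic.Linarith
import Mathlib.Tactic.Positivity
import Mathlib.Tactic.Ring
import HarnessLib

/-!
# Sums of independent, non-identically distributed terms: marginals, variance, Chebyshev

Trunk T-CPLX-CORE, generic finite probability as `Finset` sums over product types (uniform
independent coordinates). App. D campaign (design v3), generic lemma G2, of the discharge of
`Literature.Barriers.PneNP.AkaviaEtAl2006_complMemIPk` (Akavia–Goldreich–Goldwasser–Moshkovitz,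
STOC 2006, App. D), but independent of it. The tree's `SamplingDeviation*.lean` treat i.i.d.
trials through Mathlib's measure theory; the statistics of App. D that are sums of INDEPENDENT
BUT DIFFERENT terms (one hash bucket per run position, each at its own level and around its own
preimage set) need the elementary non-identical version, in counting form:

* `sum_apply_mul_card`, `sum_pi_apply_mul_card` — **one-coordinate marginals**:
  `(Σ_f G (f j)) · |B| = |ι → B| · Σ_b G b`, also for dependent products `Π k, β k`;
* `sum_apply_mul_apply_eq_zero` — a product of a mean-zero coordinate statistic with a statistic
  of another coordinate sums to zero;
* `sum_sq_sum_mul_card` — **variance of a sum of independent mean-zero terms**: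
  `(Σ_f (Σ_j Y j (f j))²) · |B| = |ι → B| · Σ_j Σ_b (Y j b)²`;
* `card_filter_le_sum_mul_sq_le`, `card_deviation_indep_mul_le` — **Chebyshev, counting form**:
  `#{f | a ≤ Σ_j Y j (f j)} · a² · |B| ≤ |ι → B| · Σ_j Σ_b (Y j b)²`.

Mathlib only, all proved, [folklore].

## References

* S. Arora, B. Barak, *Computational Complexity: A Modern Approach*, CUP 2009, Lemma A.12
  (Chebyshev), Claim A.13 (variance of a sum of pairwise independent variables).
-/

noncomputable section

namespace Literature.Computability.Complexity

namespace IndependentSums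

open Finset

variable {ι B : Type*} [Fintype ι] [DecidableEq ι] [Fintype B]

/-- **One-coordinate marginal**: summing a function of the `j`-th coordinate over all tuples
multiplies its sum over the coordinate by the number of remaining tuples:
`(Σ_f G (f j)) · |B| = |ι → B| · Σ_b G b`. [folklore] -/
theorem sum_apply_mul_card (j : ι) (G : B → ℝ) :
    (∑ f : ι → B, G (f j)) * Fintype.card B = Fintype.card (ι → B) * ∑ b, G b := by
  set e := Equiv.funSplitAt j B with he
  have hsum : ∑ f : ι → B, G (f j) = ∑ p : B × ({i // i ≠ j} → B), G p.1 := by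
    rw [← Equiv.sum_comp e.symm]
    refine Fintype.sum_congr _ _ fun p => ?_
    simp [he]
  have hcard : Fintype.card (ι → B) = Fintype.card B * Fintype.card ({i // i ≠ j} → B) := by
    rw [Fintype.card_congr e, Fintype.card_prod]
  rw [hsum, hcard, Fintype.sum_prod_type]
  simp only [sum_const, card_univ, nsmul_eq_mul, ← mul_sum]
  push_cast
  ring

/-- **One-coordinate marginal, dependent product**: for `H : Π k, β k`,
`(Σ_H g (H k₀)) · |β k₀| = |Π k, β k| · Σ_b g b`. [folklore] -/
theorem sum_pi_apply_mul_card {κ : Type*} [Fintype κ] [DecidableEq κ] {β : κ → Type*}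
    [∀ k, Fintype (β k)] (k₀ : κ) (g : β k₀ → ℝ) :
    (∑ H : (∀ k, β k), g (H k₀)) * Fintype.card (β k₀) =
      Fintype.card (∀ k, β k) * ∑ b, g b := by
  set e := Equiv.piSplitAt k₀ β with he
  have hsum : ∑ H : (∀ k, β k), g (H k₀) = ∑ p : β k₀ × (∀ k : {k // k ≠ k₀}, β k), g p.1 := by
    rw [← Equiv.sum_comp e.symm]
    refine Fintype.sum_congr _ _ fun p => ?_
    simp [he]
  have hcard : Fintype.card (∀ k, β k) =
      Fintype.card (β k₀) * Fintype.card (∀ k : {k // k ≠ k₀}, β k) := by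
    rw [Fintype.card_congr e, Fintype.card_prod]
  rw [hsum, hcard, Fintype.sum_prod_type]
  simp only [sum_const, card_univ, nsmul_eq_mul, ← mul_sum]
  push_cast
  ring

/-- **Cross terms vanish**: a mean-zero statistic of coordinate `j` times any statistic of another
coordinate `j' ≠ j` sums to zero over all tuples. [folklore] -/
theorem sum_apply_mul_apply_eq_zero {j j' : ι} (hjj' : j ≠ j') (Y Z : B → ℝ) (hY : ∑ b, Y b = 0) :
    ∑ f : ι → B, Y (f j) * Z (f j') = 0 := by
  set e := Equiv.funSplitAt j B with he
  have hsum : ∑ f : ι → B, Y (f j) * Z (f j') =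
      ∑ p : B × ({i // i ≠ j} → B), Y p.1 * Z (p.2 ⟨j', hjj'.symm⟩) := by
    rw [← Equiv.sum_comp e.symm]
    refine Fintype.sum_congr _ _ fun p => ?_
    simp [he, hjj'.symm]
  rw [hsum, Fintype.sum_prod_type, sum_comm]
  refine sum_eq_zero fun g _ => ?_
  simp only
  rw [← sum_mul, hY, zero_mul]

/-- **Variance of a sum of independent mean-zero terms**:
`(Σ_f (Σ_j Y j (f j))²) · |B| = |ι → B| · Σ_j Σ_b (Y j b)²`. [cite: AroraBarakCC2009, Claim A.13] -/
theorem sum_sq_sum_mul_card (Y : ι → B → ℝ) (hY : ∀ j, ∑ b, Y j b = 0) :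
    (∑ f : ι → B, (∑ j, Y j (f j)) ^ 2) * Fintype.card B =
      Fintype.card (ι → B) * ∑ j, ∑ b, Y j b ^ 2 := by
  -- expand the square and swap sums
  have hexp : ∑ f : ι → B, (∑ j, Y j (f j)) ^ 2 =
      ∑ j, ∑ j', ∑ f : ι → B, Y j (f j) * Y j' (f j') := by
    simp_rw [sq, sum_mul_sum]
    rw [sum_comm]
    refine sum_congr rfl fun j _ => ?_
    rw [sum_comm]
  rw [hexp, sum_mul, mul_sum]
  refine sum_congr rfl fun j _ => ?_
  -- only the diagonal term survives
  rw [sum_mul, ← Finset.add_sum_erase univ _ (mem_univ j)]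
  have hoff : ∑ j' ∈ univ.erase j, (∑ f : ι → B, Y j (f j) * Y j' (f j')) * Fintype.card B = 0 := by
    refine sum_eq_zero fun j' hj' => ?_
    rw [sum_apply_mul_apply_eq_zero (ne_of_mem_erase hj').symm (Y j) (Y j') (hY j), zero_mul]
  rw [hoff, add_zero]
  have := sum_apply_mul_card j fun b => Y j b * Y j b
  simp_rw [← sq] at this ⊢
  convert this using 2

/-- Markov on the square: `#{f | a ≤ T f} · a² ≤ Σ_f (T f)²` for `a > 0`. [cite: AroraBarakCC2009, Lemma A.12] -/
theorem card_filter_le_mul_sq_le {α : Type*} [Fintype α] (T : α → ℝ) {a : ℝ} (ha : 0 < a) :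
    ((univ.filter fun x => a ≤ T x).card : ℝ) * a ^ 2 ≤ ∑ x, T x ^ 2 := by
  classical
  rw [← nsmul_eq_mul, ← sum_const]
  refine (sum_le_sum fun x hx => ?_).trans
    (sum_le_sum_of_subset_of_nonneg (filter_subset _ _) fun x _ _ => sq_nonneg _)
  have h := (mem_filter.1 hx).2
  exact pow_le_pow_left₀ ha.le h 2

/-- **Chebyshev for sums of independent mean-zero terms, counting form**: the tuples on which
`Σ_j Y j (f j) ≥ a` (`a > 0`), times `a² |B|`, number at most `|ι → B| · Σ_j Σ_b (Y j b)²`; i.e.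
`Pr[Σ ≥ a] ≤ Var / a²` with `Var = Σ_j 𝔼[Y_j²]`. [cite: AroraBarakCC2009, Lemma A.12 and Claim A.13] -/
theorem card_deviation_indep_mul_le (Y : ι → B → ℝ) (hY : ∀ j, ∑ b, Y j b = 0) {a : ℝ} (ha : 0 < a) :
    ((univ.filter fun f : ι → B => a ≤ ∑ j, Y j (f j)).card : ℝ) * a ^ 2 * Fintype.card B ≤
      Fintype.card (ι → B) * ∑ j, ∑ b, Y j b ^ 2 := by
  classical
  rw [← sum_sq_sum_mul_card Y hY]
  exact mul_le_mul_of_nonneg_right (card_filter_le_mul_sq_le _ ha) (Nat.cast_nonneg _)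

end IndependentSums

end Literature.Computability.Complexity

end
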